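import Literature.Analysis.FluidPDE.Tao2016AveragedNS.RetunedTransition
import HarnessLib

/-!
# Tao's delay gate under NON-UNIFORM diagonal damping, part 1 of 3: energy law, signs, (ob-2)

PLACEMENT: cell-own derived work of `pub-fluidc` (blueprint seat bp1, owner of the Tao-2016 skeleton
`Literature/Analysis/FluidPDE/Tao2016AveragedNS/` and of its dictionary), filed under the host summit's topic
directory `Summits/NavierStokesRegularity/FluidComputer/` (new derived work here; `Literature/` holds cited
published statements only). ONE text in three files (400-line rule of the topic directory), one namespace
`Summit.NavierStokesRegularity.FluidComputer.DampedTransition`: this file (§0 two folklore tools, §1 the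
damped trajectory: energy law, `c ≥ 0`, (ob-2)), `DampedTransitionQuiet.lean` (§2 the quiet phase: (code),
(dora), (able2), (bogo-2), the sharp super-solution), `DampedTransitionWindow.lean` (§3 the sharp
sub-solution and the critical-time window). The Literature vocabulary (`delayCircuitWith`, `delayInit`,
`energy`, `IsCancelling`, the `Thm53` toolkit) is opened, never modified.

HONEST FRAMING (cell `pub-fluidc`, verbatim): *low prior, high value-of-information experiment on Tao's
machine paradigm; NOT a claim that NS blows up.* Everything in the three files concerns the five-mode
quadratic truncation (5.5) of [Tao2016AveragedNS, §5.5] (in the retuned form `delayCircuitWith K M ε` of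
`GateRetuning.lean`: seed `ε²e^{-M}`, amplifier `ε⁻¹M`) with an ADDED linear diagonal damping; nothing is
said about the Navier–Stokes equations.

## The question (cell item DIVERGENCE D43(b)(1), left open by `ViscousConjugacy*.lean`)

`ViscousConjugacyGate.lean` settled UNIFORM damping `-μX` of Tao's gate exactly (a change of clock: the gate
fires iff `μ < μ_*`, `4/7 ≤ μ_* ≤ 5/7`). The dissipation of a wavelet shell is diagonal but NOT uniform, and
the non-uniform part is not conjugated away; charged to the ADDITIVE defect budget of the reach certificates
it would be tolerated only at size `~ ε²e^{-M}` (`PseudoOrbitTiming.lean`). Here the printed bootstrap proof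
of [Tao2016AveragedNS, Theorem 5.3] (architecture of `RetunedTransition.lean`, namespace `Thm53With`) is
re-run for the DAMPED trajectories

  `Ẋ(t) = delayCircuitWith K M ε (X t) - E(t) * X(t)`,  `0 ≤ Eᵢ(t) ≤ η`  (pointwise product; no
  regularity of `E` is assumed),  `X(0) = (1,0,0,0,0)`,

i.e. mode `i` is damped at its own, possibly time-dependent, rate `Eᵢ(t) ∈ [0, η]`. LOCAL HYPOTHESES:
the equation and the bounds `0 ≤ Eᵢ ≤ η` are assumed on the window `[0,2]` ONLY
(`∀ t ∈ Icc 0 2, HasDerivAt X (…) t`), so that the results apply to trajectories that exist, or are so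
damped, only on a window — e.g. the conjugated trajectories `s ↦ (1-μs)⁻¹X(T_μ s)`, `s < 1/μ`, of
`ViscousConjugacy.lean` (`hasDerivWithinAt_undamp`); `Thm53With` assumes global ones. RESULT OF THE
THREE FILES (quiet phase): for `η ≤ 1/100` (a bound INDEPENDENT of `K`, `M`, `ε` — compare the additive
tolerance `ε²e^{-M}`), the seed-scale ignition of the trigger survives: the first hitting time `t_c` of
the trigger level `K⁻¹⁰ε²` exists in `[1, 3/2]` and satisfies
`2 - 24 log K / M - 18η ≤ t_c² ≤ 2 + 2/M + 20η` (`DampedTransition.quietPhase`; Tao/undamped: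
`2 - 24 log K/M ≤ t_c² ≤ 2 + 2/M`), with the quiet-phase portrait `a = 1 + O(K⁻²⁰ + η)`,
`b = εt(1 + O(K⁻²⁰ + η))`, `|d|, |ã| ≤ 3K⁻¹⁰`, `0 ≤ c ≤ K⁻¹⁰ε²` on `[0, t_c]`. MECHANISM: damping is
MULTIPLICATIVE — it cannot cancel the seed `ε²e^{-M}a²` (which stays `≥ ε²e^{-M}/2`), it only lowers the
sweep rate of the trigger from `Mt` to `≥ M(1 - 17K⁻²⁰ - 9η)t - η`; every absorption of the printed proof
goes through with `17K⁻²⁰` replaced by `θ := 17K⁻²⁰ + 9η`.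

## Contents of this file

* §0 `hasDerivAt_energy_damped`, `energy_antitoneOn_damped`, `energy_mul_exp_monotoneOn_damped` (any
  cancelling `F`, any `0 ≤ E ≤ η` on an interval: `∂ₜ|X|² = -2∑EᵢXᵢ² ∈ [-2η|X|², 0]`);
  `nonneg_of_deriv_barrier` (sign barrier: `f(a) ≥ 0`, `f' ≥ Lf` wherever `f < 0` ⇒ `f ≥ 0`; no
  regularity of coefficients); `exists_hitTime_on` (hitting time for `u` continuous on `[0,T]` only).
* §1 the damped member on `[0,2]`: `hasDerivAt_a … hasDerivAt_e`; `energy_le_one`, `traj_abs_le_one`;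
  `energy_ge_exp` (`|X|² ≥ e^{-2ηt}`); `e_nonneg`; (ob-2) `bc_small` (`|b|,|c| ≤ 5ε`); `c_nonneg`
  (sign barrier with `L = 5M`).

## What is NOT claimed (all three files)

(i) Only the QUIET phase and the critical-time window are treated; the firing phase ((c-large),
equipartition, `ã² → 1 - O(η)`) under damping is the declared successor item (bp1 HANDOFF), so NO damped
analogue of `DelayedAbruptTransitionWith` is asserted here. (ii) `η ≤ 1/100` is a sufficient tolerance
read off the printed absorptions, not a threshold; the true tolerance is not located. (iii) Nothing about
the averaged or true Navier–Stokes equations, blow-up, or Tao's infinite circuit; the rates of a real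
wavelet shell relative to a stage's clock are a matter of the cascade's spec sheet, not of this file.

Sources: [cite: Tao2016AveragedNS, §5.5 Thm 5.3, (5.5), proof pp. 28–30 (ob-2)]; the energy law and
the sign barrier are elementary [folklore]. No named facts (D-0026); 0 sorry.
-/

noncomputable section

namespace Summit.NavierStokesRegularity.FluidComputer

open Real Set Filter Topology
open Literature.Analysis.FluidPDE.Tao2016AveragedNS
open Literature.Analysis.FluidPDE.Tao2016AveragedNS.Thm53 (antitoneOn_intFactor monotoneOn_intFactor
  antitoneOn_sub_of_deriv_le monotoneOn_sub_of_le_deriv abs_sub_le_of_abs_deriv_le exists_hitTime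
  init_a init_b init_c init_d init_e)

namespace DampedTransition

/-! ## §0. Two folklore tools: the energy law of a diagonally damped cancelling circuit; a sign barrier -/

section General

variable {m : ℕ}

/-- Energy law of a diagonally damped cancelling circuit: along `Ẋ = F X - E(t) * X` (pointwise product)
`∂ₜ|X|² = -2 ∑ᵢ Eᵢ(t) Xᵢ²`. [folklore] -/
theorem hasDerivAt_energy_damped {F : (Fin m → ℝ) → (Fin m → ℝ)} (hF : IsCancelling F)
    {X E : ℝ → Fin m → ℝ} {t : ℝ} (hX : HasDerivAt X (F (X t) - E t * X t) t) :
    HasDerivAt (fun s => energy (X s)) (-(2 * ∑ i, E t i * X t i ^ 2)) t := by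
  refine (hasDerivAt_energy hX).congr_deriv ?_
  have : ∑ i, (F (X t) - E t * X t) i * X t i = ∑ i, F (X t) i * X t i - ∑ i, E t i * X t i ^ 2 := by
    rw [← Finset.sum_sub_distrib]
    exact Finset.sum_congr rfl fun i _ => by simp only [Pi.sub_apply, Pi.mul_apply]; ring
  rw [this, hF (X t)]
  ring

/-- Hence, with non-negative rates on a time interval `I`, the energy is non-increasing on `I`. [folklore] -/
theorem energy_antitoneOn_damped {F : (Fin m → ℝ) → (Fin m → ℝ)} (hF : IsCancelling F)
    {X E : ℝ → Fin m → ℝ} {I : Set ℝ} (hI : Convex ℝ I)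
    (hX : ∀ t ∈ I, HasDerivAt X (F (X t) - E t * X t) t)
    (hE : ∀ t ∈ I, ∀ i, 0 ≤ E t i) : AntitoneOn (fun t => energy (X t)) I := by
  refine antitoneOn_of_hasDerivWithinAt_nonpos hI
    (fun t ht => (hasDerivAt_energy_damped hF (hX t ht)).continuousAt.continuousWithinAt)
    (fun t ht => (hasDerivAt_energy_damped hF (hX t (interior_subset ht))).hasDerivWithinAt)
    fun t ht => ?_
  have : 0 ≤ ∑ i, E t i * X t i ^ 2 :=
    Finset.sum_nonneg fun i _ => mul_nonneg (hE t (interior_subset ht) i) (sq_nonneg _)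
  linarith

/-- And with rates `≤ η` on a time interval `I` the energy decays no faster than `e^{-2ηt}` there:
`t ↦ |X(t)|² e^{2ηt}` is non-decreasing on `I`. [folklore] -/
theorem energy_mul_exp_monotoneOn_damped {F : (Fin m → ℝ) → (Fin m → ℝ)} (hF : IsCancelling F)
    {X E : ℝ → Fin m → ℝ} {η : ℝ} {I : Set ℝ} (hI : Convex ℝ I)
    (hX : ∀ t ∈ I, HasDerivAt X (F (X t) - E t * X t) t)
    (hE : ∀ t ∈ I, ∀ i, E t i ≤ η) : MonotoneOn (fun t => energy (X t) * exp (2 * η * t)) I := by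
  have hd : ∀ t ∈ I, HasDerivAt (fun s => energy (X s) * exp (2 * η * s))
      (-(2 * ∑ i, E t i * X t i ^ 2) * exp (2 * η * t)
        + energy (X t) * (2 * η * exp (2 * η * t))) t := fun t ht =>
    (hasDerivAt_energy_damped hF (hX t ht)).mul
      (((hasDerivAt_id t).const_mul (2 * η)).exp.congr_deriv (by simp [mul_comm]))
  refine monotoneOn_of_hasDerivWithinAt_nonneg hI
    (fun t ht => (hd t ht).continuousAt.continuousWithinAt)
    (fun t ht => (hd t (interior_subset ht)).hasDerivWithinAt) fun t ht => ?_
  have h1 : ∑ i, E t i * X t i ^ 2 ≤ η * energy (X t) := by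
    rw [energy, Finset.mul_sum]
    exact Finset.sum_le_sum fun i _ =>
      mul_le_mul_of_nonneg_right (hE t (interior_subset ht) i) (sq_nonneg _)
  have h2 : 0 < exp (2 * η * t) := exp_pos _
  nlinarith

/-- **Sign barrier** (no regularity of the coefficients is needed): if `f(a) ≥ 0` and `f' ≥ L·f` at every
time of `[a,b)` at which `f < 0`, for some constant `L ≥ 0` (`f` differentiable on `[a,b]`), then
`f ≥ 0` on `[a,b]` — compare `-f` with
the barriers `δe^{(L+1)(x-a)}`, `δ ↓ 0` (`image_le_of_deriv_right_lt_deriv_boundary`). [folklore] -/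
theorem nonneg_of_deriv_barrier {f f' : ℝ → ℝ} {a b L : ℝ} (hL : 0 ≤ L)
    (hf : ∀ x ∈ Icc a b, HasDerivAt f (f' x) x) (ha : 0 ≤ f a)
    (h : ∀ x ∈ Ico a b, f x < 0 → L * f x ≤ f' x) {x : ℝ} (hx : x ∈ Icc a b) : 0 ≤ f x := by
  by_contra hneg
  have hfx : 0 < -f x := by linarith [not_le.1 hneg]
  set δ : ℝ := -f x / (2 * exp ((L + 1) * (x - a))) with hδ
  have hδ0 : 0 < δ := by positivity
  have hB : ∀ s, HasDerivAt (fun r => δ * exp ((L + 1) * (r - a)))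
      (δ * ((L + 1) * exp ((L + 1) * (s - a)))) s := fun s => by
    have h1 : HasDerivAt (fun r => (L + 1) * (r - a)) (L + 1) s := by
      simpa using ((hasDerivAt_id s).sub_const a).const_mul (L + 1)
    exact (h1.exp.const_mul δ).congr_deriv (by ring)
  have key := image_le_of_deriv_right_lt_deriv_boundary (f := fun s => -f s) (f' := fun s => -f' s)
    (a := a) (b := b) (B := fun s => δ * exp ((L + 1) * (s - a)))
    (B' := fun s => δ * ((L + 1) * exp ((L + 1) * (s - a))))
    (fun s hs => (hf s hs).neg.continuousAt.continuousWithinAt)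
    (fun s hs => (hf s (Ico_subset_Icc_self hs)).neg.hasDerivWithinAt)
    (by simp only [sub_self, mul_zero, exp_zero, mul_one]; linarith) hB
    (fun s hs hcontact => by
      have hpos : 0 < δ * exp ((L + 1) * (s - a)) := by positivity
      have hcontact' : -f s = δ * exp ((L + 1) * (s - a)) := hcontact
      have hfs : f s < 0 := by linarith
      have hLs := h s hs hfs
      show -f' s < δ * ((L + 1) * exp ((L + 1) * (s - a)))
      nlinarith)
    hx
  have hval : δ * exp ((L + 1) * (x - a)) = -f x / 2 := by
    simp only [hδ]
    field_simp
  have key' : -f x ≤ δ * exp ((L + 1) * (x - a)) := key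
  linarith

/-- First hitting time of a level `θ > u(0)` before time `T`, for `u` continuous on `[0,T]` only
(`Thm53.exists_hitTime` asks for global continuity; extend `u` by constants, `IccExtend`). [folklore] -/
theorem exists_hitTime_on {u : ℝ → ℝ} {θ T : ℝ} (hT : 0 < T) (hu : ContinuousOn u (Icc 0 T))
    (h0 : u 0 < θ) :
    ∃ τ : ℝ, 0 < τ ∧ τ ≤ T ∧ (∀ t, 0 ≤ t → t ≤ τ → u t ≤ θ) ∧ (τ < T → u τ = θ) := by
  set v : ℝ → ℝ := IccExtend hT.le ((Icc 0 T).restrict u) with hv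
  have hvc : Continuous v :=
    continuous_IccExtend_iff.2 (continuousOn_iff_continuous_restrict.1 hu)
  have hvu : ∀ t ∈ Icc 0 T, v t = u t := fun t ht => by
    simp only [hv, IccExtend_of_mem hT.le _ ht, restrict_apply]
  have hv0 : v 0 < θ := by rw [hvu 0 ⟨le_rfl, hT.le⟩]; exact h0
  obtain ⟨τ, hτ0, hτT, hle, heq⟩ := exists_hitTime hvc hT hv0
  refine ⟨τ, hτ0, hτT, fun t ht0 htτ => ?_, fun hlt => ?_⟩
  · rw [← hvu t ⟨ht0, htτ.trans hτT⟩]; exact hle t ht0 htτ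
  · rw [← hvu τ ⟨hτ0.le, hτT⟩]; exact heq hlt

end General

/-! ## §1. The damped member: components, energy, signs, (ob-2), (code) -/

section Trajectory

variable {K M ε η : ℝ} {E X : ℝ → Fin 5 → ℝ}

/-- Each mode of a damped trajectory is continuous on the window. [folklore] -/
theorem continuousOn_traj
    (hX : ∀ t ∈ Icc (0:ℝ) 2, HasDerivAt X (delayCircuitWith K M ε (X t) - E t * X t) t)
    (i : Fin 5) : ContinuousOn (fun s => X s i) (Icc 0 2) := fun t ht =>
  ((continuous_apply i).continuousAt.comp (hX t ht).continuousAt).continuousWithinAt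

/-- (a-eq), damped: `∂ₜa = -ε⁻²cd - εab - ε²e^{-M}ac - E₀a`. [cite: Tao2016AveragedNS, §5.5 (5.5)] -/
theorem hasDerivAt_a {t : ℝ} (hX : HasDerivAt X (delayCircuitWith K M ε (X t) - E t * X t) t) :
    HasDerivAt (fun s => X s 0)
      (-((ε ^ 2)⁻¹ * X t 2 * X t 3) - ε * X t 0 * X t 1
        - ε ^ 2 * exp (-M) * X t 0 * X t 2 - E t 0 * X t 0) t :=
  (hasDerivAt_pi.1 hX 0).congr_deriv (by simp [delayCircuitWith])

/-- (b-eq), damped: `∂ₜb = εa² - ε⁻¹Mc² - E₁b`. [cite: Tao2016AveragedNS, §5.5 (5.5)] -/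
theorem hasDerivAt_b {t : ℝ} (hX : HasDerivAt X (delayCircuitWith K M ε (X t) - E t * X t) t) :
    HasDerivAt (fun s => X s 1) (ε * X t 0 ^ 2 - ε⁻¹ * M * X t 2 ^ 2 - E t 1 * X t 1) t :=
  (hasDerivAt_pi.1 hX 1).congr_deriv (by simp [delayCircuitWith])

/-- (c-eq), damped: `∂ₜc = ε²e^{-M}a² + ε⁻¹Mbc - E₂c`. [cite: Tao2016AveragedNS, §5.5 (5.5)] -/
theorem hasDerivAt_c {t : ℝ} (hX : HasDerivAt X (delayCircuitWith K M ε (X t) - E t * X t) t) :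
    HasDerivAt (fun s => X s 2)
      (ε ^ 2 * exp (-M) * X t 0 ^ 2 + ε⁻¹ * M * X t 1 * X t 2 - E t 2 * X t 2) t :=
  (hasDerivAt_pi.1 hX 2).congr_deriv (by simp [delayCircuitWith])

/-- (d-eq), damped: `∂ₜd = ε⁻²ca - Kdã - E₃d`. [cite: Tao2016AveragedNS, §5.5 (5.5)] -/
theorem hasDerivAt_d {t : ℝ} (hX : HasDerivAt X (delayCircuitWith K M ε (X t) - E t * X t) t) :
    HasDerivAt (fun s => X s 3) ((ε ^ 2)⁻¹ * X t 2 * X t 0 - K * X t 3 * X t 4 - E t 3 * X t 3) t :=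
  (hasDerivAt_pi.1 hX 3).congr_deriv (by simp [delayCircuitWith])

/-- (ã-eq), damped: `∂ₜã = Kd² - E₄ã`. [cite: Tao2016AveragedNS, §5.5 (5.5)] -/
theorem hasDerivAt_e {t : ℝ} (hX : HasDerivAt X (delayCircuitWith K M ε (X t) - E t * X t) t) :
    HasDerivAt (fun s => X s 4) (K * X t 3 ^ 2 - E t 4 * X t 4) t :=
  (hasDerivAt_pi.1 hX 4).congr_deriv (by simp [delayCircuitWith])

/-- (energy-con) becomes energy DECAY: `|X(t)|² ≤ 1` for `t ≥ 0`. [cite: Tao2016AveragedNS, §5.5 (energy-con)] -/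
theorem energy_le_one
    (hX : ∀ t ∈ Icc (0:ℝ) 2, HasDerivAt X (delayCircuitWith K M ε (X t) - E t * X t) t)
    (hE : ∀ t ∈ Icc (0:ℝ) 2, ∀ i, 0 ≤ E t i ∧ E t i ≤ η) (h0 : X 0 = delayInit) {t : ℝ}
    (ht : t ∈ Icc (0:ℝ) 2) : energy (X t) ≤ 1 := by
  have h := energy_antitoneOn_damped (isCancelling_delayCircuitWith K M ε) (convex_Icc 0 2) hX
    (fun t ht i => (hE t ht i).1) ⟨le_rfl, zero_le_two⟩ ht ht.1
  have h1 : energy (X 0) = 1 := by rw [h0]; simp [energy, delayInit, Fin.sum_univ_five]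
  simpa [h1] using h

/-- … and `|X(t)|² ≥ e^{-2ηt}`: at most the fraction `1 - e^{-2ηt} ≤ 2ηt` of the unit energy is
dissipated by time `t`. [folklore] -/
theorem energy_ge_exp
    (hX : ∀ t ∈ Icc (0:ℝ) 2, HasDerivAt X (delayCircuitWith K M ε (X t) - E t * X t) t)
    (hE : ∀ t ∈ Icc (0:ℝ) 2, ∀ i, 0 ≤ E t i ∧ E t i ≤ η) (h0 : X 0 = delayInit) {t : ℝ}
    (ht : t ∈ Icc (0:ℝ) 2) : exp (-(2 * η * t)) ≤ energy (X t) := by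
  have h := energy_mul_exp_monotoneOn_damped (isCancelling_delayCircuitWith K M ε) (convex_Icc 0 2) hX
    (fun t ht i => (hE t ht i).2) ⟨le_rfl, zero_le_two⟩ ht ht.1
  have h1 : energy (X 0) = 1 := by rw [h0]; simp [energy, delayInit, Fin.sum_univ_five]
  simp only [h1, mul_zero, exp_zero, one_mul] at h
  rw [exp_neg, inv_le_iff_one_le_mul₀ (exp_pos _)]
  exact h

/-- (est): `Xᵢ² ≤ 1` for `t ≥ 0`. [cite: Tao2016AveragedNS, §5.5 (est)] -/
theorem traj_sq_le_one
    (hX : ∀ t ∈ Icc (0:ℝ) 2, HasDerivAt X (delayCircuitWith K M ε (X t) - E t * X t) t)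
    (hE : ∀ t ∈ Icc (0:ℝ) 2, ∀ i, 0 ≤ E t i ∧ E t i ≤ η) (h0 : X 0 = delayInit) {t : ℝ}
    (ht : t ∈ Icc (0:ℝ) 2) (i : Fin 5) : X t i ^ 2 ≤ 1 := by
  have h := energy_le_one hX hE h0 ht
  rw [energy] at h
  exact le_trans (Finset.single_le_sum (f := fun j => X t j ^ 2) (fun j _ => sq_nonneg (X t j))
    (Finset.mem_univ i)) h

/-- (est): `|Xᵢ| ≤ 1` for `t ≥ 0`. [cite: Tao2016AveragedNS, §5.5 (est)] -/
theorem traj_abs_le_one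
    (hX : ∀ t ∈ Icc (0:ℝ) 2, HasDerivAt X (delayCircuitWith K M ε (X t) - E t * X t) t)
    (hE : ∀ t ∈ Icc (0:ℝ) 2, ∀ i, 0 ≤ E t i ∧ E t i ≤ η) (h0 : X 0 = delayInit) {t : ℝ}
    (ht : t ∈ Icc (0:ℝ) 2) (i : Fin 5) : |X t i| ≤ 1 :=
  sq_le_one_iff_abs_le_one _ |>.1 (traj_sq_le_one hX hE h0 ht i)

/-- `ã ≥ 0` for `t ≥ 0` (sign barrier: `∂ₜã = Kd² - E₄ã ≥ 0` wherever `ã < 0`); `ã` is no longer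
monotone. [cite: Tao2016AveragedNS, §5.5 proof] -/
theorem e_nonneg
    (hX : ∀ t ∈ Icc (0:ℝ) 2, HasDerivAt X (delayCircuitWith K M ε (X t) - E t * X t) t)
    (hE : ∀ t ∈ Icc (0:ℝ) 2, ∀ i, 0 ≤ E t i ∧ E t i ≤ η) (h0 : X 0 = delayInit) (hK : 0 ≤ K) {t : ℝ}
    (ht : t ∈ Icc (0:ℝ) 2) : 0 ≤ X t 4 := by
  refine nonneg_of_deriv_barrier (L := 0) (b := t) le_rfl
    (fun s hs => hasDerivAt_e (hX s ⟨hs.1, hs.2.trans ht.2⟩)) (by rw [init_e h0])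
    (fun s hs hs' => ?_) ⟨ht.1, le_rfl⟩
  have h1 : 0 ≤ K * X s 3 ^ 2 := by positivity
  have h2 : 0 ≤ -(E s 4 * X s 4) := by
    rw [neg_nonneg]
    exact mul_nonpos_of_nonneg_of_nonpos (hE s ⟨hs.1, hs.2.le.trans ht.2⟩ 4).1 hs'.le
  linarith

/-- `∂ₜ(b² + c²) = 2εa²b + 2ε²e^{-M}a²c - 2E₁b² - 2E₂c²` — the amplifier still cancels.
[cite: Tao2016AveragedNS, §5.5 proof (ob-2)] -/
theorem bc_energy {t : ℝ} (hX : HasDerivAt X (delayCircuitWith K M ε (X t) - E t * X t) t) :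
    HasDerivAt (fun s => X s 1 ^ 2 + X s 2 ^ 2)
      (2 * ε * X t 0 ^ 2 * X t 1 + 2 * ε ^ 2 * exp (-M) * X t 0 ^ 2 * X t 2
        - 2 * E t 1 * X t 1 ^ 2 - 2 * E t 2 * X t 2 ^ 2) t := by
  refine (((hasDerivAt_pi.1 hX 1).fun_pow 2).fun_add ((hasDerivAt_pi.1 hX 2).fun_pow 2)).congr_deriv ?_
  simp only [show (2 : ℕ) - 1 = 1 from rfl, pow_one, Nat.cast_ofNat, delayCircuitWith, Fin.isValue,
    Matrix.cons_val_one, Matrix.cons_val_two, Matrix.cons_val_zero, Matrix.head_cons,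
    Matrix.tail_cons, Pi.sub_apply, Pi.mul_apply]
  ring

/-- `∂ₜ(d² + ã²) = 2ε⁻²c·a·d - 2E₃d² - 2E₄ã²` — the drain still cancels.
[cite: Tao2016AveragedNS, §5.5 proof (dora)] -/
theorem out_energy {t : ℝ} (hX : HasDerivAt X (delayCircuitWith K M ε (X t) - E t * X t) t) :
    HasDerivAt (fun s => X s 3 ^ 2 + X s 4 ^ 2)
      (2 * (ε ^ 2)⁻¹ * X t 2 * X t 0 * X t 3 - 2 * E t 3 * X t 3 ^ 2 - 2 * E t 4 * X t 4 ^ 2) t := by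
  refine (((hasDerivAt_pi.1 hX 3).fun_pow 2).fun_add ((hasDerivAt_pi.1 hX 4).fun_pow 2)).congr_deriv ?_
  simp only [show (2 : ℕ) - 1 = 1 from rfl, pow_one, Nat.cast_ofNat, delayCircuitWith, Fin.isValue,
    Matrix.cons_val, Pi.sub_apply, Pi.mul_apply]
  ring

/-- (ob-2) survives damping: `|b|, |c| ≤ 5ε` on `[0,2]` (the damping terms `-2E₁b² - 2E₂c² ≤ 0` only
help in `∂ₜ√(b²+c²+ε²) ≤ 2ε`). [cite: Tao2016AveragedNS, §5.5 (ob-2)] -/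
theorem bc_small
    (hX : ∀ t ∈ Icc (0:ℝ) 2, HasDerivAt X (delayCircuitWith K M ε (X t) - E t * X t) t)
    (hE : ∀ t ∈ Icc (0:ℝ) 2, ∀ i, 0 ≤ E t i ∧ E t i ≤ η) (h0 : X 0 = delayInit)
    (hε : 0 < ε) (hε1 : ε ≤ 1) (hM0 : 0 ≤ M) {t : ℝ} (ht : t ∈ Icc 0 2) :
    |X t 1| ≤ 5 * ε ∧ |X t 2| ≤ 5 * ε := by
  set f : ℝ → ℝ := fun s => X s 1 ^ 2 + X s 2 ^ 2 with hf
  set h : ℝ → ℝ := fun s => sqrt (f s + ε ^ 2) with hh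
  have hfpos : ∀ s, 0 < f s + ε ^ 2 := fun s => by positivity
  have hb_le : ∀ s, |X s 1| ≤ h s := fun s =>
    abs_le_sqrt (by simp only [hf]; nlinarith [sq_nonneg (X s 2)])
  have hc_le : ∀ s, |X s 2| ≤ h s := fun s =>
    abs_le_sqrt (by simp only [hf]; nlinarith [sq_nonneg (X s 1)])
  have hder : ∀ s ∈ Icc (0:ℝ) 2, HasDerivAt h
      ((2 * ε * X s 0 ^ 2 * X s 1 + 2 * ε ^ 2 * exp (-M) * X s 0 ^ 2 * X s 2
        - 2 * E s 1 * X s 1 ^ 2 - 2 * E s 2 * X s 2 ^ 2) / (2 * sqrt (f s + ε ^ 2))) s :=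
    fun s hs => ((bc_energy (hX s hs)).add_const (ε ^ 2)).sqrt (hfpos s).ne'
  have hbound : ∀ s ∈ Icc (0:ℝ) 2,
      (2 * ε * X s 0 ^ 2 * X s 1 + 2 * ε ^ 2 * exp (-M) * X s 0 ^ 2 * X s 2
        - 2 * E s 1 * X s 1 ^ 2 - 2 * E s 2 * X s 2 ^ 2) / (2 * sqrt (f s + ε ^ 2)) ≤ 2 * ε := by
    intro s hs
    have hhpos : 0 < sqrt (f s + ε ^ 2) := sqrt_pos.2 (hfpos s)
    rw [div_le_iff₀ (by positivity)]
    have ha : X s 0 ^ 2 ≤ 1 := traj_sq_le_one hX hE h0 hs 0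
    have ha0 : 0 ≤ X s 0 ^ 2 := sq_nonneg _
    have hek : exp (-M) ≤ 1 := by rw [exp_le_one_iff, neg_nonpos]; exact hM0
    have hb1 : X s 1 ≤ h s := (le_abs_self _).trans (hb_le s)
    have hc1 : X s 2 ≤ h s := (le_abs_self _).trans (hc_le s)
    have hh0 : 0 ≤ h s := (abs_nonneg _).trans (hb_le s)
    have h1 : X s 0 ^ 2 * X s 1 ≤ h s := by nlinarith
    have h21 : ε ^ 2 * exp (-M) ≤ ε := by
      calc ε ^ 2 * exp (-M) ≤ ε ^ 2 * 1 := mul_le_mul_of_nonneg_left hek (sq_nonneg _)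
        _ = ε * ε := by ring
        _ ≤ ε * 1 := mul_le_mul_of_nonneg_left hε1 hε.le
        _ = ε := mul_one _
    have hεe : 0 ≤ ε ^ 2 * exp (-M) := by positivity
    have h22 : |X s 0 ^ 2 * X s 2| ≤ h s := by
      rw [abs_mul, abs_of_nonneg ha0]; nlinarith [abs_nonneg (X s 2), hc_le s]
    have h23 : ε ^ 2 * exp (-M) * (X s 0 ^ 2 * X s 2) ≤ ε * h s := by
      calc ε ^ 2 * exp (-M) * (X s 0 ^ 2 * X s 2)
          ≤ ε ^ 2 * exp (-M) * |X s 0 ^ 2 * X s 2| :=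
            mul_le_mul_of_nonneg_left (le_abs_self _) hεe
        _ ≤ ε * h s := mul_le_mul h21 h22 (abs_nonneg _) hε.le
    have hD : 0 ≤ 2 * E s 1 * X s 1 ^ 2 + 2 * E s 2 * X s 2 ^ 2 := by
      have := (hE s hs 1).1; have := (hE s hs 2).1; positivity
    have h1' : 2 * ε * X s 0 ^ 2 * X s 1 ≤ 2 * ε * h s := by nlinarith
    have : h s = sqrt (f s + ε ^ 2) := rfl
    rw [← this]
    nlinarith
  -- `h - 2εt` is antitone on `[0,2]`
  have hanti := antitoneOn_sub_of_deriv_le (convex_Icc 0 2) hder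
    (fun s _ => ((hasDerivAt_id s).const_mul (2 * ε))) (fun s hs => by simpa using hbound s hs)
  have h0mem : (0 : ℝ) ∈ Icc (0 : ℝ) 2 := ⟨le_rfl, by norm_num⟩
  have hmono := hanti h0mem ht ht.1
  have hh0' : h 0 = ε := by
    simp only [hh, hf, init_b h0, init_c h0]
    simpa using sqrt_sq hε.le
  simp only [hh0', id, mul_zero, sub_zero] at hmono
  have hht : h t ≤ 5 * ε := by
    have := ht.2
    nlinarith
  exact ⟨(hb_le t).trans hht, (hc_le t).trans hht⟩

/-- `c ≥ 0` on `[0,2]`: the sign barrier with `L = 5M` (`∂ₜc = ε²e^{-M}a² + (ε⁻¹Mb - E₂)c ≥ 5M·c`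
wherever `c < 0`, as `|ε⁻¹Mb| ≤ 5M` by (ob-2) and `-E₂c ≥ 0` there). [cite: Tao2016AveragedNS, §5.5 proof] -/
theorem c_nonneg
    (hX : ∀ t ∈ Icc (0:ℝ) 2, HasDerivAt X (delayCircuitWith K M ε (X t) - E t * X t) t)
    (hE : ∀ t ∈ Icc (0:ℝ) 2, ∀ i, 0 ≤ E t i ∧ E t i ≤ η) (h0 : X 0 = delayInit)
    (hε : 0 < ε) (hε1 : ε ≤ 1) (hM0 : 0 ≤ M) {t : ℝ} (ht : t ∈ Icc 0 2) : 0 ≤ X t 2 := by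
  refine nonneg_of_deriv_barrier (L := 5 * M) (b := 2) (by positivity)
    (fun s hs => hasDerivAt_c (hX s hs)) (by rw [init_c h0]) (fun s hs hcs => ?_) ht
  have hb : |X s 1| ≤ 5 * ε := (bc_small hX hE h0 hε hε1 hM0 ⟨hs.1, hs.2.le⟩).1
  have hνb : |ε⁻¹ * M * X s 1| ≤ 5 * M := by
    rw [abs_mul, abs_of_nonneg (by positivity : 0 ≤ ε⁻¹ * M)]
    calc ε⁻¹ * M * |X s 1| ≤ ε⁻¹ * M * (5 * ε) := mul_le_mul_of_nonneg_left hb (by positivity)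
      _ = 5 * M := by field_simp
  have h1 : 5 * M * X s 2 ≤ ε⁻¹ * M * X s 1 * X s 2 := by
    -- `c < 0` and `ν b ≤ |ν b| ≤ 5M`
    have hle : ε⁻¹ * M * X s 1 ≤ 5 * M := (le_abs_self _).trans hνb
    nlinarith
  have h2 : 0 ≤ -(E s 2 * X s 2) := by
    rw [neg_nonneg]; exact mul_nonpos_of_nonneg_of_nonpos (hE s ⟨hs.1, hs.2.le⟩ 2).1 hcs.le
  have h3 : 0 ≤ ε ^ 2 * exp (-M) * X s 0 ^ 2 := by positivity
  linarith

end Trajectory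

end DampedTransition

end Summit.NavierStokesRegularity.FluidComputer
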